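import Literature.MathematicalPhysics.StatisticalMechanics.BarlowStackingEnergy
import Literature.MathematicalPhysics.StatisticalMechanics.PeriodicConfigurationSums
import Summits.AtomisticToContinuum.Crystallization.Theorems.PricedLinkCensusTruncatedCensusGapBlocksTruncLJ
import Summits.AtomisticToContinuum.Crystallization.Theorems.MinMeanCycleStackingLockBarlowEnergyIdentification

/-!
# Energy per particle of a periodic Barlow stacking under the truncated Lennard-Jones potential

Stub `energyPerParticle_barlow_truncLJ_eq_average` (ENERGY PER PARTICLE OF A PERIODIC BARLOW
STACKING under the range-2 truncated Lennard-Jones potential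
`V_χ = min 1 (max 0 (4 - 2r)) · V_LJ` = AVERAGE SITE ENERGY OVER A PERIOD) of the line
`sharp-m-potential-compactness` for the crux `PricedLinkCensus.TruncatedCensusGap`
(item stmt-AtomisticToContinuum-14230).  The statement at the end is the registered signature
VERBATIM; it is the `V_χ` twin of the Lennard-Jones identification
`energyPerParticle_barlow_eq_average` of
`Theorems/MinMeanCycleStackingLockBarlowEnergyIdentification.lean`.

For `a, h > 0` and a `p`-periodic sequence `s` (`p ≠ 0`), the energy per particle
(`PeriodicConfiguration.energyPerParticle`: `(2·#F)⁻¹ Σ_{x ∈ F} Σ'_{y ∈ points, y ≠ x} V(|x − y|)`)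
of `barlowPeriodicConfiguration s ha hh hp hs` (motif the `p` distinct points
`barlowPos a h s m 0 0`, `m < p`, point set `barlowStacking a h s`) equals the period average
`p⁻¹ Σ_{m < p} barlowSiteEnergy V a h s m` of the site energies of `BarlowStackingEnergy.lean`
(the same punctured sums, organised layer by layer).

## Proof layout

The bookkeeping of the Lennard-Jones template is run for a GENERAL pair potential `V` with
`V 0 = 0` whose punctured sums over the point set are summable:

* `summable_barlowPos_of_summable_points`: summability over the point set, seen through the
  injective parametrisation `(k, i, j) ↦ barlowPos a h s k i j` of the stacking by `ℤ³`
  (`barlowPos_injective`), is summability over `ℤ³`;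
* `tsum_points_eq_tsum_barlowPos_of`: the punctured sum from a stacking point is the full
  `ℤ³`-sum (the missing diagonal term is `V 0 = 0`);
* `tsum_points_eq_two_mul_barlowSiteEnergy_of`: the `ℤ³`-sum, computed layer by layer
  (`Summable.tsum_prod`) and split into the base layer, the layers above and the layers below
  (`tsum_of_add_one_of_neg_add_one`), is `2 · barlowSiteEnergy V a h s m`;
* `energyPerParticle_barlow_eq_average_of`: sum over the motif (`Finset.sum_image`,
  `Finset.card_image_of_injective`).

For `V = V_χ` the two hypotheses are `truncLJ_zero` and `summable_truncLJ_dist`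
(`PricedLinkCensusTruncatedCensusGapBlocksTruncLJ.lean`: `‖V_χ‖ ≤ |V_LJ|` and the Lennard-Jones
lattice sums of a periodic configuration of `ℝ³` converge absolutely).
-/

noncomputable section

namespace Summit.AtomisticToContinuum.Crystallization.Theorems.PricedLinkCensusTruncatedCensusGap

open Finset
open Literature.MathematicalPhysics.StatisticalMechanics

/-! ### The layer bookkeeping for a general pair potential -/

section GeneralPotential

variable {V : ℝ → ℝ} {a h : ℝ} {s : ℤ → ℤ} {p : ℕ}

/-- **Summability over the stacking in the parametrisation by `ℤ³`.** For `a, h > 0`, a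
`p`-periodic sequence `s` (`p ≠ 0`), a point `x` and a pair potential `V` whose punctured sum
`Σ_{y ∈ points, y ≠ x} V(|x − y|)` over the point set of `barlowPeriodicConfiguration` is
summable, `(k, i, j) ↦ V (dist x (barlowPos a h s k i j))` is summable (the point set is the
stacking, parametrised injectively by `ℤ³`; at most one index is the point `x` itself).
[folklore] -/
theorem summable_barlowPos_of_summable_points (ha : 0 < a) (hh : 0 < h) (ha' : a ≠ 0)
    (hh' : h ≠ 0) (hp : p ≠ 0) (hs : ∀ i, s (i + p) = s i) (x : EuclideanSpace ℝ (Fin 3))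
    (hF : Summable fun y : {y // y ∈ (barlowPeriodicConfiguration s ha' hh' hp hs).points ∧
      y ≠ x} => V (dist x y.1)) :
    Summable fun q : ℤ × ℤ × ℤ => V (dist x (barlowPos a h s q.1 q.2.1 q.2.2)) := by
  set P := barlowPeriodicConfiguration s ha' hh' hp hs with hPdef
  have hP : P.points = barlowStacking a h s := barlowPeriodicConfiguration_points s ha' hh' hp hs
  set g : ℤ × ℤ × ℤ → EuclideanSpace ℝ (Fin 3) := fun q => barlowPos a h s q.1 q.2.1 q.2.2
    with hgdef
  have hg : Function.Injective g := barlowPos_injective ha hh s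
  -- the (at most one) index whose point is `x` itself
  have hS : (g ⁻¹' {x}).Finite := (Set.subsingleton_singleton.preimage hg).finite
  have hmem : ∀ q, g q ∈ P.points := fun q => by
    rw [hP]
    exact barlowPos_mem _ _ _
  let φ : ↥(g ⁻¹' {x})ᶜ → {y // y ∈ P.points ∧ y ≠ x} :=
    fun c => ⟨g c.1, hmem c.1, fun hc => c.2 hc⟩
  have hφ : Function.Injective φ := by
    intro c c' hcc'
    have h1 : g c.1 = g c'.1 := congrArg Subtype.val hcc'
    exact Subtype.ext (hg h1)
  have h1 : Summable ((fun y : {y // y ∈ P.points ∧ y ≠ x} => V (dist x y.1)) ∘ φ) :=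
    hF.comp_injective hφ
  have h2 : Summable ((fun q : ℤ × ℤ × ℤ => V (dist x (g q))) ∘
      ((↑) : ↥(g ⁻¹' {x})ᶜ → ℤ × ℤ × ℤ)) := h1
  exact hS.summable_compl_iff.1 h2

/-- **The punctured sum over the stacking seen from a stacking point is the full
`ℤ³`-parametrised sum**, for a pair potential with `V 0 = 0` (the bijection `barlowPos`; the
missing diagonal term is `V 0 = 0`). [folklore] -/
theorem tsum_points_eq_tsum_barlowPos_of (hV0 : V 0 = 0) (ha : 0 < a) (hh : 0 < h) (ha' : a ≠ 0)
    (hh' : h ≠ 0) (hp : p ≠ 0) (hs : ∀ i, s (i + p) = s i) (m : ℤ) :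
    ∑' y : {y // y ∈ (barlowPeriodicConfiguration s ha' hh' hp hs).points ∧
        y ≠ barlowPos a h s m 0 0}, V (dist (barlowPos a h s m 0 0) y.1) =
      ∑' q : ℤ × ℤ × ℤ, V (dist (barlowPos a h s m 0 0) (barlowPos a h s q.1 q.2.1 q.2.2)) := by
  set P := barlowPeriodicConfiguration s ha' hh' hp hs with hPdef
  have hP : P.points = barlowStacking a h s := barlowPeriodicConfiguration_points s ha' hh' hp hs
  set g : ℤ × ℤ × ℤ → EuclideanSpace ℝ (Fin 3) := fun q => barlowPos a h s q.1 q.2.1 q.2.2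
    with hgdef
  have hg : Function.Injective g := barlowPos_injective ha hh s
  set q₀ : ℤ × ℤ × ℤ := (m, 0, 0) with hq₀
  have hx : g q₀ = barlowPos a h s m 0 0 := rfl
  have hmem : ∀ q, g q ∈ P.points := fun q => by
    rw [hP]
    exact barlowPos_mem _ _ _
  let φ : ↥({q₀}ᶜ : Set (ℤ × ℤ × ℤ)) → {y // y ∈ P.points ∧ y ≠ barlowPos a h s m 0 0} :=
    fun c => ⟨g c.1, hmem c.1, fun hc => c.2 (hg (hc.trans hx.symm))⟩
  have hφ : Function.Injective φ := by
    intro c c' hcc'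
    have h1 : g c.1 = g c'.1 := congrArg Subtype.val hcc'
    exact Subtype.ext (hg h1)
  -- `φ` is onto: every point of the stacking is some `barlowPos k i j`
  have hsurj : Function.support
      (fun y : {y // y ∈ P.points ∧ y ≠ barlowPos a h s m 0 0} =>
        V (dist (barlowPos a h s m 0 0) y.1)) ⊆ Set.range φ := by
    intro y _
    have hy : y.1 ∈ barlowStacking a h s := by
      rw [← hP]
      exact y.2.1
    obtain ⟨k, i, j, hk⟩ := hy
    have hne : ((k, i, j) : ℤ × ℤ × ℤ) ∈ ({q₀}ᶜ : Set (ℤ × ℤ × ℤ)) := by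
      intro hq
      have hq' : g (k, i, j) = g q₀ := by rw [Set.mem_singleton_iff.1 hq]
      exact y.2.2 (hk.trans (hq'.trans hx))
    exact ⟨⟨(k, i, j), hne⟩, Subtype.ext hk.symm⟩
  have key := hφ.tsum_eq hsurj
  rw [← key]
  have h0 : Function.support (fun q : ℤ × ℤ × ℤ =>
      V (dist (barlowPos a h s m 0 0) (g q))) ⊆ ({q₀}ᶜ : Set (ℤ × ℤ × ℤ)) := by
    intro q hq
    rw [Function.mem_support] at hq
    simp only [Set.mem_compl_iff, Set.mem_singleton_iff]
    rintro rfl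
    exact hq (by simp only [hx, dist_self, hV0])
  exact tsum_subtype_eq_of_support_subset h0

/-- **The energy of a site of layer `m`, as a sum over the stacking**, for a pair potential with
`V 0 = 0` and summable punctured sums: the punctured sum `∑_{y ≠ x} V(|x - y|)` over the point
set of `barlowPeriodicConfiguration`, for `x = barlowPos a h s m 0 0`, equals
`2 · barlowSiteEnergy V a h s m` (the same sum organised layer by layer). [folklore] -/
theorem tsum_points_eq_two_mul_barlowSiteEnergy_of (hV0 : V 0 = 0) (ha : 0 < a) (hh : 0 < h)
    (ha' : a ≠ 0) (hh' : h ≠ 0) (hp : p ≠ 0) (hs : ∀ i, s (i + p) = s i) (m : ℤ)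
    (hF : Summable fun y : {y // y ∈ (barlowPeriodicConfiguration s ha' hh' hp hs).points ∧
      y ≠ barlowPos a h s m 0 0} => V (dist (barlowPos a h s m 0 0) y.1)) :
    ∑' y : {y // y ∈ (barlowPeriodicConfiguration s ha' hh' hp hs).points ∧
        y ≠ barlowPos a h s m 0 0}, V (dist (barlowPos a h s m 0 0) y.1) =
      2 * barlowSiteEnergy V a h s m := by
  have hF' := summable_barlowPos_of_summable_points ha hh ha' hh' hp hs (barlowPos a h s m 0 0) hF
  -- layer by layer: the fibre over `k` is `layerInteraction (L k - L m) (k - m)`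
  have e2 : ∑' q : ℤ × ℤ × ℤ, V (dist (barlowPos a h s m 0 0) (barlowPos a h s q.1 q.2.1 q.2.2)) =
      ∑' k : ℤ, layerInteraction V a h (haggLabel s k - haggLabel s m) (k - m) :=
    hF'.tsum_prod.trans (tsum_congr fun k => tsum_layer V a h s m k)
  have hG : Summable fun k : ℤ => layerInteraction V a h (haggLabel s k - haggLabel s m) (k - m) :=
    hF'.prod.congr fun k => tsum_layer V a h s m k
  -- recentre at `m` and split into `k = m`, `k > m`, `k < m`
  have e1 : ∑' k : ℤ, layerInteraction V a h (haggLabel s k - haggLabel s m) (k - m) =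
      ∑' t : ℤ, layerInteraction V a h (haggLabel s (m + t) - haggLabel s m) (m + t - m) :=
    ((Equiv.addLeft m).tsum_eq fun k =>
      layerInteraction V a h (haggLabel s k - haggLabel s m) (k - m)).symm
  have hG' : Summable fun t : ℤ =>
      layerInteraction V a h (haggLabel s (m + t) - haggLabel s m) (m + t - m) :=
    hG.comp_injective (Equiv.addLeft m).injective
  have h1 : Summable fun n : ℕ => layerInteraction V a h
      (haggLabel s (m + ((n : ℤ) + 1)) - haggLabel s m) (m + ((n : ℤ) + 1) - m) :=
    hG'.comp_injective (i := fun n : ℕ => (n : ℤ) + 1)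
      fun n n' (hn : (n : ℤ) + 1 = (n' : ℤ) + 1) => by omega
  have h2 : Summable fun n : ℕ => layerInteraction V a h
      (haggLabel s (m + -((n : ℤ) + 1)) - haggLabel s m) (m + -((n : ℤ) + 1) - m) :=
    hG'.comp_injective (i := fun n : ℕ => -((n : ℤ) + 1))
      fun n n' (hn : -((n : ℤ) + 1) = -((n' : ℤ) + 1)) => by omega
  have e3 : ∑' t : ℤ, layerInteraction V a h (haggLabel s (m + t) - haggLabel s m) (m + t - m) =
      (∑' n : ℕ, layerInteraction V a h
        (haggLabel s (m + ((n : ℤ) + 1)) - haggLabel s m) (m + ((n : ℤ) + 1) - m)) +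
      layerInteraction V a h (haggLabel s (m + 0) - haggLabel s m) (m + 0 - m) +
      ∑' n : ℕ, layerInteraction V a h
        (haggLabel s (m + -((n : ℤ) + 1)) - haggLabel s m) (m + -((n : ℤ) + 1) - m) :=
    tsum_of_add_one_of_neg_add_one (f := fun t : ℤ =>
      layerInteraction V a h (haggLabel s (m + t) - haggLabel s m) (m + t - m)) h1 h2
  -- identify the three pieces with those of `barlowSiteEnergy`
  have e0 : layerInteraction V a h (haggLabel s (m + 0) - haggLabel s m) (m + 0 - m) =
      ∑' ij : ℤ × ℤ, (if ij = 0 then 0 else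
        V (dist (barlowPos a h s m 0 0) (barlowPos a h s m ij.1 ij.2))) := by
    rw [add_zero, sub_self, sub_self, tsum_inLayer, layerInteraction, inLayerInteraction]
    refine tsum_congr fun ij => ?_
    split_ifs with hij
    · subst hij
      simp [layerVec, hV0]
    · rw [layerVec_zero_zero]
  have eB : (∑' n : ℕ, layerInteraction V a h
        (haggLabel s (m + ((n : ℤ) + 1)) - haggLabel s m) (m + ((n : ℤ) + 1) - m)) =
      ∑' k : ℕ, ∑' ij : ℤ × ℤ, V
        (dist (barlowPos a h s m 0 0) (barlowPos a h s (m + (k + 1 : ℕ)) ij.1 ij.2)) :=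
    tsum_congr fun n => by
      rw [tsum_layer]
      have : m + ((n : ℤ) + 1) = m + ((n + 1 : ℕ) : ℤ) := by push_cast; ring
      rw [this]
  have eC : (∑' n : ℕ, layerInteraction V a h
        (haggLabel s (m + -((n : ℤ) + 1)) - haggLabel s m) (m + -((n : ℤ) + 1) - m)) =
      ∑' k : ℕ, ∑' ij : ℤ × ℤ, V
        (dist (barlowPos a h s m 0 0) (barlowPos a h s (m - (k + 1 : ℕ)) ij.1 ij.2)) :=
    tsum_congr fun n => by
      rw [tsum_layer]
      have : m + -((n : ℤ) + 1) = m - ((n + 1 : ℕ) : ℤ) := by push_cast; ring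
      rw [this]
  rw [tsum_points_eq_tsum_barlowPos_of hV0 ha hh ha' hh' hp hs m, e2, e1, e3, e0, eB, eC,
    barlowSiteEnergy]
  ring

/-- **Energy per particle of a periodic Barlow stacking = average site energy over a period**,
for a pair potential with `V 0 = 0` and summable punctured sums over the point set:
`e(barlowPeriodicConfiguration) = p⁻¹ ∑_{m<p} barlowSiteEnergy V a h s m` (the motif consists of
the `p` distinct points `barlowPos a h s m 0 0`, `m < p`). [folklore] -/
theorem energyPerParticle_barlow_eq_average_of (hV0 : V 0 = 0) (ha : 0 < a) (hh : 0 < h)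
    (ha' : a ≠ 0) (hh' : h ≠ 0) (hp : p ≠ 0) (hs : ∀ i, s (i + p) = s i)
    (hF : ∀ x : EuclideanSpace ℝ (Fin 3), Summable fun y : {y //
      y ∈ (barlowPeriodicConfiguration s ha' hh' hp hs).points ∧ y ≠ x} => V (dist x y.1)) :
    (barlowPeriodicConfiguration s ha' hh' hp hs).energyPerParticle V =
      (∑ m ∈ range p, barlowSiteEnergy V a h s m) / p := by
  have hsum : ∑ m ∈ range p, ∑' y : {y //
        y ∈ (barlowPeriodicConfiguration s ha' hh' hp hs).points ∧ y ≠ barlowPos a h s m 0 0},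
        V (dist (barlowPos a h s m 0 0) y.1) =
      ∑ m ∈ range p, 2 * barlowSiteEnergy V a h s m :=
    Finset.sum_congr rfl fun m _ =>
      tsum_points_eq_two_mul_barlowSiteEnergy_of hV0 ha hh ha' hh' hp hs m (hF _)
  set P := barlowPeriodicConfiguration s ha' hh' hp hs with hPdef
  have hmotif : P.motif = (range p).image fun m : ℕ => barlowPos a h s m 0 0 := by
    ext y
    simp only [hPdef, barlowPeriodicConfiguration, Finset.mem_image, Finset.mem_range]
  have hinj : Function.Injective fun m : ℕ => barlowPos a h s m 0 0 := by
    intro m m' hmm'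
    have h2 := congrArg (fun v : EuclideanSpace ℝ (Fin 3) => v 2) hmm'
    simp only [barlowPos_apply_two, Int.cast_natCast] at h2
    exact_mod_cast mul_right_cancel₀ hh' h2
  have e : ∑ x ∈ (range p).image (fun m : ℕ => barlowPos a h s m 0 0),
      ∑' y : {y // y ∈ P.points ∧ y ≠ x}, V (dist x y.1) =
      ∑ m ∈ range p, ∑' y : {y // y ∈ P.points ∧ y ≠ barlowPos a h s m 0 0},
        V (dist (barlowPos a h s m 0 0) y.1) :=
    Finset.sum_image fun x _ y _ hxy => hinj hxy
  rw [PeriodicConfiguration.energyPerParticle, hmotif, Finset.card_image_of_injective _ hinj,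
    Finset.card_range, e, hsum, ← Finset.mul_sum]
  ring

end GeneralPotential

/-! ### The registered statement -/

/-- **ENERGY PER PARTICLE OF A PERIODIC BARLOW STACKING under the range-2 truncated
Lennard-Jones potential `V_χ = min 1 (max 0 (4 - 2r)) · V_LJ` = AVERAGE SITE ENERGY OVER A
PERIOD** (registered stub `energyPerParticle_barlow_truncLJ_eq_average` of the line
`sharp-m-potential-compactness`): for `a, h > 0` and a `p`-periodic sequence `s`,
`e_{V_χ}(barlowPeriodicConfiguration s) = p⁻¹ ∑_{m<p} barlowSiteEnergy V_χ a h s m` — the general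
bookkeeping `energyPerParticle_barlow_eq_average_of` with `V_χ 0 = 0` (`truncLJ_zero`) and the
summable `V_χ` lattice sums of a periodic configuration (`summable_truncLJ_dist`). [folklore] -/
theorem energyPerParticle_barlow_truncLJ_eq_average : ∀ (a h : ℝ) (s : ℤ → ℤ) (p : ℕ) (ha : a ≠ 0) (hh : h ≠ 0) (hp : p ≠ 0) (hs : ∀ i : ℤ, s (i + p) = s i), 0 < a → 0 < h → (barlowPeriodicConfiguration s ha hh hp hs).energyPerParticle (fun r => min 1 (max 0 (4 - 2 * r)) * lennardJones r) = (∑ m ∈ Finset.range p, barlowSiteEnergy (fun r => min 1 (max 0 (4 - 2 * r)) * lennardJones r) a h s m) / p := by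
  intro a h s p ha hh hp hs ha0 hh0
  exact energyPerParticle_barlow_eq_average_of (V := fun r => min 1 (max 0 (4 - 2 * r)) *
    lennardJones r) truncLJ_zero ha0 hh0 ha hh hp hs
    (summable_truncLJ_dist (barlowPeriodicConfiguration s ha hh hp hs))

end Summit.AtomisticToContinuum.Crystallization.Theorems.PricedLinkCensusTruncatedCensusGap

end
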